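/-
Copyright: the b2b-balaban T⁴-continuum CRUX team, leaf lineage `t4-ne7b-formalise-leaf-04` (gen 162). Project licence.
-/
import Summits.QuantumFields.BalabanUV.T4Continuum.Spine.NE7b.SupEquationTwoSteps

/-!
# THE EQUATION-MAP TOWER IS A SEMIGROUP AT THE LEVEL OF BACKGROUNDS: after two steps of `…SupEquationTwoSteps.twoSteps_eq` the
# twice-transported background `σ₁(σ₂ v)` satisfies the COMPOSITE step's equations — `Q₂(Q(σ₁(σ₂ v))) = v` and THE COMPOSITE LIFT
# IDENTITY `Eq(σ₁(σ₂ v)) = Lp(Lp₂(Q₂(Q(Eq(σ₁(σ₂ v))))))` (blocking `Q₂∘Q`, lift `Lp∘Lp₂`) —, hence, whenever the ONE-SHOT composite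
# step's chart is supplied, `σ₁ ∘ σ₂` IS the one-shot composite branch `σ₁₂` on the two-step ball (SIS uniqueness)
# (row NE7b, node U5c; STS ∕ SIS BY NAME; [folklore]; any Banach currency)

Cell `pub-balaban`, sub-cell `t4`, spine estimate NE7b (`T4WeightBudget.RelWeightBound`; the cell's OWN estimate — NOT PRINTED
in [Bałaban 1983–89], NOT PROVED).  Crux-route work under `Spine/NE7b/` by leaf lineage `t4-ne7b-formalise-leaf-04` (gen 162) under
FREEZE (0)'s crux-prover clause (FILING-CLAIM C-ne7bleaf04g162-9; a COROLLARY FILE of leaf-06 g160's `…SupEquationTwoSteps` (STS)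
— the equation-map analogue of this lineage's `…SoftStepBlockingSemigroup` «two averaging soft steps are one»).  NOTHING of
Bałaban's is named as a Lean object, valued or asserted; no `T4Continuum/Support` leaf typed; no `def`, no notation; zero `sorry`.
Import: `…SupEquationTwoSteps` only (through it `…SupInductiveStep` (SIS), HSCR ∕ HSBD ∕ HSBDM).

WHY (located).  Print's multi-scale analysis composes averaging operations (`Q_{k+1} = Q ∘ Q_k`) and reads the background of the
composite blocking; the hard-step road instead takes ONE step at a time, re-entering with the next equation map `Q∘Eq∘σ₁` (STS).
The two pictures agree: STS's two lift identities CHAIN — `Eq(σ₁ w) = Lp(Q(Eq(σ₁ w)))` at `w = σ₂ v` and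
`Q(Eq(σ₁(σ₂ v))) = Lp₂(Q₂(Q(Eq(σ₁(σ₂ v)))))` — to the lift identity of the COMPOSITE blocking, and `Q₂(Q(σ₁(σ₂ v))) = Q₂(σ₂ v) = v`;
so `σ₁(σ₂ v)` solves the composite step's constrained equation, and SIS's uniqueness clause for the composite data (its chart
DISPLAYED, as every chart on this road) identifies it with the one-shot composite branch.  This is the consistency the tower needs
to be read at any grouping of its steps; it costs no estimate.

WHAT IS PROVED ([folklore]; `E F F₂ K K₂ K₁₂` real normed spaces, `E`, `F` complete and nontrivial):
* §0 `section_eq_symm_inl` (a linear section of `Q` killed by `S` IS the chart's section `A⁻¹(·, 0)` for `A = (Q, S)`),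
  `chartReading_of_section_unique` (hence `twoSteps_eq`'s universal next-chart reading `hT₂` is discharged by ONE reading
  `T₂ h = (Q₂ h, R₂(A₀⁻¹(h, 0)))` at the perturbed chart `A₀ = (Q, P∘Eq′(0))` — exported on `ℓ^∞` by (61) ∕ LNSB §4).
* §1 **`twoSteps_composite_lift`** — `twoSteps_eq`'s hypotheses VERBATIM ⟹ its conclusions AND, on the two-step ball
  `‖v‖ ≤ (N₂⁻¹ − c₂)r₂`: `σ₁(σ₂ v) ∈ closedBall 0 r`, `Q₂(Q(σ₁(σ₂ v))) = v`, `P(Eq(σ₁(σ₂ v))) = 0`, `P₂(Q(Eq(σ₁(σ₂ v)))) = 0`, and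
  THE COMPOSITE LIFT IDENTITY `Eq(σ₁(σ₂ v)) = Lp(Lp₂(Q₂(Q(Eq(σ₁(σ₂ v))))))`.
* §2 **`twoSteps_eq_oneShot`** — THE SEMIGROUP: additionally the composite step's SIS data on `E` — a fibre reading
  `ι₁₂(P₁₂ h) = h − Lp(Lp₂(Q₂(Q h)))` with `ι₁₂` injective on `0` (`ι₁₂ κ = 0 → κ = 0`), `‖P₁₂‖ ≤ C_{P₁₂}`, a composite chart
  `T₁₂ h = (Q₂(Q h), P₁₂(A h))` with `‖T₁₂⁻¹ y‖ ≤ N₁₂‖y‖`, smallness `‖P₁₂∘(Eq′ x − A)‖ ≤ c₁₂ < N₁₂⁻¹` on `closedBall 0 r` ⟹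
  `∃ σ₁ σ₂ σ₁₂`: §1's letters, the one-shot branch `σ₁₂` with SIS's (a) letters for `(Q₂∘Q, Lp∘Lp₂, P₁₂)`, and
  **`σ₁(σ₂ v) = σ₁₂ v` for every `‖v‖ ≤ (N₂⁻¹ − c₂)r₂`**.
* §3 toy.

NOT HERE (honest): the charts `T`, `T₂`, `T₁₂` BY VALUE (ASE at sides `n+1` and `(n+1)²` for the free part on `ℓ^∞(ℤ^d)`); any
comparison of the RADII of the two routes (the two-step ball vs the one-shot ball — numbers, (A3)); the `n`-fold statement over `ℕ`;
anything of Bałaban's.  BY-NAME EFFECT ON THE WALL: NONE.  NE7b NOT PRINTED ∕ NOT PROVED; spine PROVED 0∕9; rung (B)+1 on a FINITE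
torus — NOT infinite volume, NOT the mass gap, NOT Clay.  HONEST DEPENDENCY: continuum YM on T⁴ ⇐ BetaPertH ∧ nine spine estimates
(0∕9 proved); BetaPertH ⇐ (D1) ∧ (D4) ∧ CAP+tail; G-an2-4 gates asym, D1 and NE2∕3∕4.
-/

set_option autoImplicit false

noncomputable section

namespace Summit.QuantumFields.BalabanUV.T4Continuum.NE7b.SupEquationTowerSemigroup

open Set Metric Function
open scoped NNReal
open Summit.QuantumFields.BalabanUV.T4Continuum.NE7b

variable {E F F₂ K K₂ K₁₂ : Type*} [NormedAddCommGroup E] [NormedSpace ℝ E] [NormedAddCommGroup F] [NormedSpace ℝ F]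
  [NormedAddCommGroup F₂] [NormedSpace ℝ F₂] [NormedAddCommGroup K] [NormedSpace ℝ K] [NormedAddCommGroup K₂] [NormedSpace ℝ K₂]
  [NormedAddCommGroup K₁₂] [NormedSpace ℝ K₁₂]

/-! ## §0. Admissible sections are unique: the universal chart reading of `twoSteps_eq` is consistent and dischargeable -/

/-- **ADMISSIBLE SECTIONS ARE UNIQUE.**  For a chart `A h = (Q h, S h)`: a linear section `S′` of `Q` (`Q(S′ k) = k`) killed by `S`
(`S(S′ k) = 0`) is the chart's own section, `S′ k = A⁻¹(k, 0)`.  Hence the universal-section hypothesis `hT₂` of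
`…SupEquationTwoSteps.twoSteps_eq` quantifies over a singleton as soon as the perturbed chart `(Q, P∘Eq′(0))` is an equivalence
(exported on `ℓ^∞` by (61) ∕ `…LocalNemytskiiSupBall` §4 at `w = 0`). [folklore] -/
theorem section_eq_symm_inl (A : E ≃L[ℝ] F × K) (Q : E →L[ℝ] F)
    (S : E →L[ℝ] K) (hA : ∀ h, A h = (Q h, S h)) {S' : F →L[ℝ] E} (hQ : ∀ k, Q (S' k) = k) (hS : ∀ k, S (S' k) = 0)
    (k : F) : S' k = A.symm (k, 0) := by
  rw [ContinuousLinearEquiv.eq_symm_apply, hA, hQ, hS]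

/-- **THE NEXT CHART's UNIVERSAL READING, DISCHARGED.**  If the perturbed chart at `0` is an equivalence `A₀ h = (Q h, S h)` and
`T₂` reads `(Q₂, R₂ ∘ A₀⁻¹ ∘ inl)` for some `R₂ : E →L K₂`, then `T₂` reads `(Q₂, R₂ ∘ S′)` for EVERY linear section `S′` of `Q`
killed by `S` — the shape of `twoSteps_eq`'s `hT₂` with `S := P∘Eq′(0)`, `R₂ := P₂∘Q∘Eq′(0)`. [folklore] -/
theorem chartReading_of_section_unique (A₀ : E ≃L[ℝ] F × K) (Q : E →L[ℝ] F) (S : E →L[ℝ] K) (hA : ∀ h, A₀ h = (Q h, S h))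
    (Q₂ : F →L[ℝ] F₂) (R₂ : E →L[ℝ] K₂) (T₂ : F ≃L[ℝ] F₂ × K₂)
    (hT₂ : ∀ h, T₂ h = (Q₂ h, R₂ (A₀.symm (h, 0)))) :
    ∀ S' : F →L[ℝ] E, Q.comp S' = ContinuousLinearMap.id ℝ F → (∀ k, S (S' k) = 0) →
      ∀ h, T₂ h = (Q₂ h, R₂ (S' h)) := by
  intro S' hQ hS h
  have hQ' : ∀ k, Q (S' k) = k := fun k => by
    have e := congrArg (fun L : F →L[ℝ] F => L k) hQ
    simpa only [ContinuousLinearMap.comp_apply, ContinuousLinearMap.id_apply] using e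
  rw [hT₂, section_eq_symm_inl A₀ Q S hA hQ' hS h]

/-! ## §1. Two steps satisfy the composite step's equations -/

/-- **TWO STEPS SATISFY THE COMPOSITE STEP's EQUATIONS.**  Under `twoSteps_eq`'s hypotheses (verbatim): its conclusions, and on the
two-step ball `‖v‖ ≤ (N₂⁻¹ − c₂)·r₂` the twice-transported background `σ₁(σ₂ v)` lies in `closedBall 0 r`, is blocked to `v` by the
COMPOSITE blocking `Q₂ ∘ Q`, is fibre-critical for both steps, and satisfies THE COMPOSITE LIFT IDENTITY
`Eq(σ₁(σ₂ v)) = Lp(Lp₂(Q₂(Q(Eq(σ₁(σ₂ v))))))`. [folklore] -/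
theorem twoSteps_composite_lift [CompleteSpace E] [Nontrivial E] [CompleteSpace F] [Nontrivial F]
    (Q : E →L[ℝ] F) (Lp : F →L[ℝ] E) (P : E →L[ℝ] K) (ι : K →L[ℝ] E)
    (hPι : ∀ h, ι (P h) = h - Lp (Q h)) {CP : ℝ} (hCP : ‖P‖ ≤ CP)
    {Eq : E → E} {Eq' : E → E →L[ℝ] E} (hE0 : Eq 0 = 0) {r : ℝ} (hr : 0 ≤ r)
    (hE : ∀ x ∈ closedBall (0 : E) r, HasFDerivAt Eq (Eq' x) x)
    {B M₃ : ℝ} (hB : ∀ x ∈ closedBall (0 : E) r, ‖Eq' x‖ ≤ B) (hM₃ : 0 ≤ M₃)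
    (hM : ∀ x ∈ closedBall (0 : E) r, ∀ x' ∈ closedBall (0 : E) r, ‖Eq' x - Eq' x'‖ ≤ M₃ * ‖x - x'‖)
    (A : E →L[ℝ] E) (T : E ≃L[ℝ] F × K) (hT : ∀ h, T h = (Q h, P (A h))) {N c : ℝ≥0}
    (hN : ∀ y : F × K, ‖T.symm y‖ ≤ N * ‖y‖) (hcN : c < N⁻¹)
    (hc : ∀ x ∈ closedBall (0 : E) r, ‖P.comp (Eq' x - A)‖ ≤ c)
    -- scale `k + 1`
    {r₂ : ℝ} (hr₂0 : 0 ≤ r₂) (hr₂ : r₂ < ((N : ℝ)⁻¹ - c) * r)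
    (Q₂ : F →L[ℝ] F₂) (Lp₂ : F₂ →L[ℝ] F) (P₂ : F →L[ℝ] K₂) (ι₂ : K₂ →L[ℝ] F) (hPι₂ : ∀ h, ι₂ (P₂ h) = h - Lp₂ (Q₂ h))
    {CP₂ : ℝ} (hCP₂ : ‖P₂‖ ≤ CP₂) (T₂ : F ≃L[ℝ] F₂ × K₂) {N₂ c₂ : ℝ≥0}
    (hT₂ : ∀ S : F →L[ℝ] E, Q.comp S = ContinuousLinearMap.id ℝ F → (∀ k, P (Eq' 0 (S k)) = 0) →
      ∀ h, T₂ h = (Q₂ h, P₂ (Q (Eq' 0 (S h)))))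
    (hN₂ : ∀ y : F₂ × K₂, ‖T₂.symm y‖ ≤ N₂ * ‖y‖) (hcN₂ : c₂ < N₂⁻¹)
    (hc₂ : CP₂ * (‖Q‖ * (M₃ * ((N : ℝ)⁻¹ - c)⁻¹ * ((N : ℝ)⁻¹ - c)⁻¹ +
      B * ((((N : ℝ)⁻¹ - c)⁻¹) ^ 2 * (CP * M₃) * ((N : ℝ)⁻¹ - c)⁻¹))) * r₂ ≤ (c₂ : ℝ)) :
    ∃ (σ₁ : F → E) (σ₂ : F₂ → F), σ₁ 0 = 0 ∧ σ₂ 0 = 0 ∧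
      (∀ w ∈ closedBall (0 : F) (((N : ℝ)⁻¹ - c) * r),
        σ₁ w ∈ closedBall (0 : E) r ∧ Q (σ₁ w) = w ∧ P (Eq (σ₁ w)) = 0 ∧ Eq (σ₁ w) = Lp (Q (Eq (σ₁ w)))) ∧
      (∀ v ∈ closedBall (0 : F₂) (((N₂ : ℝ)⁻¹ - c₂) * r₂),
        σ₂ v ∈ closedBall (0 : F) r₂ ∧ Q₂ (σ₂ v) = v ∧ P₂ (Q (Eq (σ₁ (σ₂ v)))) = 0 ∧
          Q (Eq (σ₁ (σ₂ v))) = Lp₂ (Q₂ (Q (Eq (σ₁ (σ₂ v)))))) ∧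
      LipschitzOnWith (N₂⁻¹ - c₂)⁻¹ σ₂ (closedBall (0 : F₂) (((N₂ : ℝ)⁻¹ - c₂) * r₂)) ∧
      (∀ v ∈ closedBall (0 : F₂) (((N₂ : ℝ)⁻¹ - c₂) * r₂), Q₂ (Q (Eq (σ₁ (σ₂ v)))) = 0 → Eq (σ₁ (σ₂ v)) = 0) ∧
      -- the composite step's equations
      (∀ v ∈ closedBall (0 : F₂) (((N₂ : ℝ)⁻¹ - c₂) * r₂),
        σ₁ (σ₂ v) ∈ closedBall (0 : E) r ∧ (Q₂.comp Q) (σ₁ (σ₂ v)) = v ∧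
          P (Eq (σ₁ (σ₂ v))) = 0 ∧ P₂ (Q (Eq (σ₁ (σ₂ v)))) = 0 ∧
          Eq (σ₁ (σ₂ v)) = (Lp.comp Lp₂) ((Q₂.comp Q) (Eq (σ₁ (σ₂ v))))) := by
  obtain ⟨σ₁, σ₂, h10, h20, h1a, h2a, h2lip, h2d⟩ :=
    SupEquationTwoSteps.twoSteps_eq Q Lp P ι hPι hCP hE0 hr hE hB hM₃ hM A T hT hN hcN hc hr₂0 hr₂ Q₂ Lp₂ P₂ ι₂ hPι₂ hCP₂ T₂
      hT₂ hN₂ hcN₂ hc₂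
  refine ⟨σ₁, σ₂, h10, h20, h1a, h2a, h2lip, h2d, fun v hv => ?_⟩
  obtain ⟨hm2, hq2, hp2, hl2⟩ := h2a v hv
  -- `σ₂ v` lies in the first step's chart ball
  have hw : σ₂ v ∈ closedBall (0 : F) (((N : ℝ)⁻¹ - c) * r) := closedBall_subset_closedBall hr₂.le hm2
  obtain ⟨hm1, hq1, hp1, hl1⟩ := h1a (σ₂ v) hw
  refine ⟨hm1, ?_, hp1, hp2, ?_⟩
  · rw [ContinuousLinearMap.comp_apply, hq1, hq2]
  · -- chain the two lift identities
    rw [ContinuousLinearMap.comp_apply, ContinuousLinearMap.comp_apply, ← hl2]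
    exact hl1

/-! ## §2. The semigroup: two steps ARE the one-shot composite step where both are defined -/

/-- **THE TOWER IS A SEMIGROUP ON BACKGROUNDS.**  §1's hypotheses, and the COMPOSITE step's `inductiveStep_eq` data on `E`: a
fibre reading `ι₁₂(P₁₂ h) = h − Lp(Lp₂(Q₂(Q h)))` with `ι₁₂ κ = 0 → κ = 0`, `‖P₁₂‖ ≤ C_{P₁₂}`, a composite chart
`T₁₂ h = (Q₂(Q h), P₁₂(A h))` with `‖T₁₂⁻¹ y‖ ≤ N₁₂‖y‖`, and smallness `‖P₁₂∘(Eq′ x − A)‖ ≤ c₁₂ < N₁₂⁻¹` on `closedBall 0 r` ⟹ the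
two-step backgrounds `σ₁`, `σ₂` of §1, the ONE-SHOT composite branch `σ₁₂ : F₂ → E` (`σ₁₂ 0 = 0`; on `‖v‖ ≤ (N₁₂⁻¹ − c₁₂)r`:
`σ₁₂ v ∈ closedBall 0 r`, `Q₂(Q(σ₁₂ v)) = v`, `P₁₂(Eq(σ₁₂ v)) = 0`, the composite lift identity; Lipschitz; uniqueness in the
`r`-ball), and **`σ₁(σ₂ v) = σ₁₂ v` for every `‖v‖ ≤ (N₂⁻¹ − c₂)·r₂`** — SIS's uniqueness for the composite data at
`x := σ₁(σ₂ v)`, which §1 shows to be admissible. [folklore] -/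
theorem twoSteps_eq_oneShot [CompleteSpace E] [Nontrivial E] [CompleteSpace F] [Nontrivial F]
    (Q : E →L[ℝ] F) (Lp : F →L[ℝ] E) (P : E →L[ℝ] K) (ι : K →L[ℝ] E)
    (hPι : ∀ h, ι (P h) = h - Lp (Q h)) {CP : ℝ} (hCP : ‖P‖ ≤ CP)
    {Eq : E → E} {Eq' : E → E →L[ℝ] E} (hE0 : Eq 0 = 0) {r : ℝ} (hr : 0 ≤ r)
    (hE : ∀ x ∈ closedBall (0 : E) r, HasFDerivAt Eq (Eq' x) x)
    {B M₃ : ℝ} (hB : ∀ x ∈ closedBall (0 : E) r, ‖Eq' x‖ ≤ B) (hM₃ : 0 ≤ M₃)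
    (hM : ∀ x ∈ closedBall (0 : E) r, ∀ x' ∈ closedBall (0 : E) r, ‖Eq' x - Eq' x'‖ ≤ M₃ * ‖x - x'‖)
    (A : E →L[ℝ] E) (T : E ≃L[ℝ] F × K) (hT : ∀ h, T h = (Q h, P (A h))) {N c : ℝ≥0}
    (hN : ∀ y : F × K, ‖T.symm y‖ ≤ N * ‖y‖) (hcN : c < N⁻¹)
    (hc : ∀ x ∈ closedBall (0 : E) r, ‖P.comp (Eq' x - A)‖ ≤ c)
    -- scale `k + 1`
    {r₂ : ℝ} (hr₂0 : 0 ≤ r₂) (hr₂ : r₂ < ((N : ℝ)⁻¹ - c) * r)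
    (Q₂ : F →L[ℝ] F₂) (Lp₂ : F₂ →L[ℝ] F) (P₂ : F →L[ℝ] K₂) (ι₂ : K₂ →L[ℝ] F) (hPι₂ : ∀ h, ι₂ (P₂ h) = h - Lp₂ (Q₂ h))
    {CP₂ : ℝ} (hCP₂ : ‖P₂‖ ≤ CP₂) (T₂ : F ≃L[ℝ] F₂ × K₂) {N₂ c₂ : ℝ≥0}
    (hT₂ : ∀ S : F →L[ℝ] E, Q.comp S = ContinuousLinearMap.id ℝ F → (∀ k, P (Eq' 0 (S k)) = 0) →
      ∀ h, T₂ h = (Q₂ h, P₂ (Q (Eq' 0 (S h)))))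
    (hN₂ : ∀ y : F₂ × K₂, ‖T₂.symm y‖ ≤ N₂ * ‖y‖) (hcN₂ : c₂ < N₂⁻¹)
    (hc₂ : CP₂ * (‖Q‖ * (M₃ * ((N : ℝ)⁻¹ - c)⁻¹ * ((N : ℝ)⁻¹ - c)⁻¹ +
      B * ((((N : ℝ)⁻¹ - c)⁻¹) ^ 2 * (CP * M₃) * ((N : ℝ)⁻¹ - c)⁻¹))) * r₂ ≤ (c₂ : ℝ))
    -- the one-shot composite step's data
    (P₁₂ : E →L[ℝ] K₁₂) (ι₁₂ : K₁₂ →L[ℝ] E) (hPι₁₂ : ∀ h, ι₁₂ (P₁₂ h) = h - Lp (Lp₂ (Q₂ (Q h))))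
    (hι₁₂ : ∀ κ : K₁₂, ι₁₂ κ = 0 → κ = 0) {CP₁₂ : ℝ} (hCP₁₂ : ‖P₁₂‖ ≤ CP₁₂)
    (T₁₂ : E ≃L[ℝ] F₂ × K₁₂) (hT₁₂ : ∀ h, T₁₂ h = (Q₂ (Q h), P₁₂ (A h))) {N₁₂ c₁₂ : ℝ≥0}
    (hN₁₂ : ∀ y : F₂ × K₁₂, ‖T₁₂.symm y‖ ≤ N₁₂ * ‖y‖) (hcN₁₂ : c₁₂ < N₁₂⁻¹)
    (hc₁₂ : ∀ x ∈ closedBall (0 : E) r, ‖P₁₂.comp (Eq' x - A)‖ ≤ c₁₂) :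
    ∃ (σ₁ : F → E) (σ₂ : F₂ → F) (σ₁₂ : F₂ → E), σ₁ 0 = 0 ∧ σ₂ 0 = 0 ∧ σ₁₂ 0 = 0 ∧
      (∀ w ∈ closedBall (0 : F) (((N : ℝ)⁻¹ - c) * r),
        σ₁ w ∈ closedBall (0 : E) r ∧ Q (σ₁ w) = w ∧ P (Eq (σ₁ w)) = 0 ∧ Eq (σ₁ w) = Lp (Q (Eq (σ₁ w)))) ∧
      (∀ v ∈ closedBall (0 : F₂) (((N₂ : ℝ)⁻¹ - c₂) * r₂),
        σ₂ v ∈ closedBall (0 : F) r₂ ∧ Q₂ (σ₂ v) = v ∧ P₂ (Q (Eq (σ₁ (σ₂ v)))) = 0 ∧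
          Q (Eq (σ₁ (σ₂ v))) = Lp₂ (Q₂ (Q (Eq (σ₁ (σ₂ v)))))) ∧
      -- the one-shot composite branch
      (∀ v ∈ closedBall (0 : F₂) (((N₁₂ : ℝ)⁻¹ - c₁₂) * r),
        σ₁₂ v ∈ closedBall (0 : E) r ∧ Q₂ (Q (σ₁₂ v)) = v ∧ P₁₂ (Eq (σ₁₂ v)) = 0 ∧
          Eq (σ₁₂ v) = Lp (Lp₂ (Q₂ (Q (Eq (σ₁₂ v)))))) ∧
      LipschitzOnWith (N₁₂⁻¹ - c₁₂)⁻¹ σ₁₂ (closedBall (0 : F₂) (((N₁₂ : ℝ)⁻¹ - c₁₂) * r)) ∧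
      (∀ x ∈ closedBall (0 : E) r, P₁₂ (Eq x) = 0 → σ₁₂ (Q₂ (Q x)) = x) ∧
      -- THE SEMIGROUP
      (∀ v ∈ closedBall (0 : F₂) (((N₂ : ℝ)⁻¹ - c₂) * r₂), σ₁ (σ₂ v) = σ₁₂ v) := by
  obtain ⟨σ₁, σ₂, h10, h20, h1a, h2a, -, -, hcomp⟩ :=
    twoSteps_composite_lift Q Lp P ι hPι hCP hE0 hr hE hB hM₃ hM A T hT hN hcN hc hr₂0 hr₂ Q₂ Lp₂ P₂ ι₂ hPι₂ hCP₂ T₂ hT₂ hN₂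
      hcN₂ hc₂
  -- the one-shot composite step: SIS with blocking `Q₂ ∘ Q`, lift `Lp ∘ Lp₂`, fibre reading `P₁₂`
  have hPι' : ∀ h, ι₁₂ (P₁₂ h) = h - (Lp.comp Lp₂) ((Q₂.comp Q) h) := fun h => by
    rw [hPι₁₂, ContinuousLinearMap.comp_apply, ContinuousLinearMap.comp_apply]
  have hT' : ∀ h, T₁₂ h = ((Q₂.comp Q) h, P₁₂ (A h)) := fun h => by rw [hT₁₂, ContinuousLinearMap.comp_apply]
  obtain ⟨σ₁₂, h120, h12a, h12lip, h12uniq, -, -, -, -, -, -⟩ :=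
    SupInductiveStep.inductiveStep_eq (Q₂.comp Q) (Lp.comp Lp₂) P₁₂ ι₁₂ hPι' hCP₁₂ hE0 hr hE hB hM₃ hM A T₁₂ hT' hN₁₂ hcN₁₂
      hc₁₂
  refine ⟨σ₁, σ₂, σ₁₂, h10, h20, h120, h1a, h2a, fun v hv => ?_, h12lip, fun x hx hPx => ?_, fun v hv => ?_⟩
  · obtain ⟨hm, hq, hp, hl⟩ := h12a v hv
    refine ⟨hm, ?_, hp, ?_⟩
    · rw [← ContinuousLinearMap.comp_apply]; exact hq
    · rw [ContinuousLinearMap.comp_apply, ContinuousLinearMap.comp_apply] at hl; exact hl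
  · have h := h12uniq x hx hPx
    rwa [ContinuousLinearMap.comp_apply] at h
  · -- admissibility of `σ₁(σ₂ v)` for the composite step (§1), then SIS uniqueness
    obtain ⟨hm, hq, -, -, hl⟩ := hcomp v hv
    have hP0 : P₁₂ (Eq (σ₁ (σ₂ v))) = 0 := by
      refine hι₁₂ _ ?_
      rw [hPι', ← hl, sub_self]
    have h := h12uniq (σ₁ (σ₂ v)) hm hP0
    rw [hq] at h
    exact h.symm

/-! ## §3. Toy -/

/-- Toy: the composite blocking on `ℝ` — blocking by `2` then by `3` is blocking by `6`:
`(3 • id) ∘ (2 • id) = 6 • id` as continuous linear maps. -/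
example : ((3 : ℝ) • ContinuousLinearMap.id ℝ ℝ).comp ((2 : ℝ) • ContinuousLinearMap.id ℝ ℝ) =
    (6 : ℝ) • ContinuousLinearMap.id ℝ ℝ := by
  ext; simp; norm_num

end Summit.QuantumFields.BalabanUV.T4Continuum.NE7b.SupEquationTowerSemigroup

end
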